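import Summits.QuantumFields.YangMills.Theorems.ColdStartUniversalityShenZhuZhuLinkSusceptibilitySUN
import Summits.QuantumFields.YangMills.Theorems.ColdStartUniversalityShenZhuZhuTorusWilsonLoopVarianceSU2
import HarnessLib

/-!
# Variance of Lipschitz cylinder observables and of WILSON LOOPS on every torus `(ℤ/L)^d`, for EVERY `SU(N)` and EVERY dimension `d`, at strong
# coupling `|β| < 1/(8d)`: `Var_{Λ_L,Nβ}(W_C) ≤ Σ_e mult_C(e)²/(N K)`, `Var_{Λ_L,Nβ}(W_{R×T}) ≤ 2(R+T)/(N K)`, `K = N/2 − 4dN|β|` — PERIMETER growth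

Seat `ym-line-csu-p1` (g39), route `ColdStartUniversality` of `Summits/QuantumFields/YangMills`, helper file G23 (fixed lattice, strong
coupling; `--supports stmt-QuantumFields-24809`).  g38's G10 (`…ShenZhuZhuTorusWilsonLoopVarianceSU2`) proved these bounds for `SU(2)`, `d = 3`
from the seat's own Bakry–Émery package.  With G21's torus Poincaré inequality in Lipschitz form for every `SU(N)` and `d`
(`torus_variance_le_of_linkLipschitz_sun`, kernel-checked multi-link Bakry–Émery inequality of the venture `YMGap`) the same follows in general:

* §1 `linkLipschitz_cylinder_torus`, `sum_sq_cylinderLipschitz_torus`, ★★ `torus_cylinder_variance_sun` — a smooth cylinder `F = f((U_e)_{e∈Λ})`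
  over a finite `Λ ⊂ E⁺(ℤ^d)` mapped injectively to the torus, `ℓ_e`-Lipschitz in the link `e`, read on the periodic lift, has
  `Var_{μ_{Λ_L,Nβ}}(F∘lift) ≤ Σ_e ℓ_e²/K`.
* §2 ★★★ `torus_wilsonLoop_variance_sun` — for every closed lattice walk `C` whose links stay distinct on `(ℤ/L)^d`,
  `Var_{μ_{Λ_L,Nβ}}(W_C∘lift) ≤ Σ_{e∈links(C)} mult_C(e)²/(N·K)`, `W_C = (1/N) Re tr hol_C` (Lipschitz constants `mult_C(e)/√N`, g38 G5); `…_of_isTrail`: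
  `≤ |C|/(N·K)`.
* §3 ★★★ `torus_wilsonLoop_rect_variance_sun` — tree vocabulary: `Var[wilsonLoop (fundamentalRep (Fin N)) x i j R T; wilsonMeasure (fundamentalRep (Fin N)) (Nβ)]
  ≤ 2(R+T)/(N·K)` for every torus base point, `i ≠ j`, `1 ≤ R, T < L` — perimeter growth of Wilson-loop fluctuations, the same in every volume,
  every `SU(N)`, every `d ≥ 2` (Shen–Zhu–Zhu Cor. 1.5 / Rem. 4.6 shape, sharp window).

THEOREMS ONLY, no definition, no sorry.  HONEST FRAMING: STRONG coupling, FIXED finite tori; no area law, nothing at weak coupling / in the continuum,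
nothing `K`-uniform along the route's scaling (`UniformColdStartMixing`, 24809, ASIDE, not restated); no crux, rung or summit statement is proved; the
Yang–Mills mass gap is NOT proved.

References: H. Shen, R. Zhu, X. Zhu, CMP 400 (2023) 805–851 = arXiv:2204.12737, Cor. 4.4 (4.11), Cor. 1.5, Rem. 4.6 [ShenZhuZhu2022].
-/

set_option autoImplicit false

noncomputable section

namespace Summit.QuantumFields.YangMills.Theorems.ColdStartUniversality

open MeasureTheory ProbabilityTheory Finset Filter Set Function
open scoped BigOperators NNReal ENNReal Topology Matrix Matrix.Norms.Frobenius ContDiff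
open SimpleGraph
open Literature.Probability.LatticeModels (zdGraph Torus.proj Torus.proj_apply)
open Literature.MathematicalPhysics.QuantumFieldTheory
open Literature.MathematicalPhysics.QuantumLattice (fundamentalRep continuous_fundamentalRep fundamentalRep_apply torusEdge torusLift LGConfig
  normalisedCharacter wilsonLoopObs rectWalk)
open Literature.MathematicalPhysics.QuantumFieldTheory.SUNBakryEmery (SUN)
open Summit.Ventures.YMGap.LatticeBakryEmery (PSU Cfg emb emb_apply LinkLipschitz)
open Summit.Ventures.YMGap.RobustBall (dartMult)

variable {d N L : ℕ} [NeZero L]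

/-! ## §1. Cylinder observables read on the torus -/

omit [NeZero L] in
/-- **A link-Lipschitz cylinder read on the torus is link-Lipschitz in the torus links**: if `Λ ⊂ E⁺(ℤ^d)` maps injectively to `(ℤ/L)^d` and `f` is
`ℓ_{e'}`-Lipschitz in each `e' ∈ Λ`, then `Q ↦ f((Q_{ē'})_{e'∈Λ})` is `Σ_{e'↦e} ℓ_{e'}`-Lipschitz in the torus link `e` (at most one `e'` lies over `e`).
[folklore] -/
theorem linkLipschitz_cylinder_torus (Λ : Finset (Literature.MathematicalPhysics.QuantumLattice.ZdEdge d))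
    (hinj : Set.InjOn (torusEdge (d := d) L) ↑Λ) (f : (↥Λ → Matrix (Fin N) (Fin N) ℂ) → ℝ) (ℓ : ↥Λ → ℝ) (hℓ : ∀ e, 0 ≤ ℓ e)
    (hLip : ∀ (e : ↥Λ) (M M' : ↥Λ → SUN N), (∀ e', e' ≠ e → M e' = M' e') →
      |f (fun e' => (M e' : Matrix (Fin N) (Fin N) ℂ)) - f (fun e' => (M' e' : Matrix (Fin N) (Fin N) ℂ))| ≤ ℓ e * suFrobDist (M e) (M' e)) :
    LinkLipschitz (fun Q : Cfg (Edge d L) N => f fun e' : ↥Λ => Q (torusEdge L e'.1))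
      (fun e => ∑ e' : ↥Λ, if torusEdge L e'.1 = e then ℓ e' else 0) := by
  classical
  intro e g h hgh
  dsimp only
  have hM : (fun e' : ↥Λ => emb g (torusEdge L e'.1)) = fun e' : ↥Λ => ((g (torusEdge L e'.1) : SUN N) : Matrix (Fin N) (Fin N) ℂ) :=
    funext fun e' => emb_apply g _
  have hM' : (fun e' : ↥Λ => emb h (torusEdge L e'.1)) = fun e' : ↥Λ => ((h (torusEdge L e'.1) : SUN N) : Matrix (Fin N) (Fin N) ℂ) :=
    funext fun e' => emb_apply h _
  rw [hM, hM']
  by_cases hex : ∃ e₀ : ↥Λ, torusEdge L e₀.1 = e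
  · obtain ⟨e₀, he₀⟩ := hex
    have huniq : ∀ e' : ↥Λ, e' ≠ e₀ → torusEdge L e'.1 ≠ e := by
      intro e' hne hEq
      exact hne (Subtype.ext (hinj e'.2 e₀.2 (hEq.trans he₀.symm)))
    have hagree : ∀ e' : ↥Λ, e' ≠ e₀ → (g (torusEdge L e'.1) : SUN N) = h (torusEdge L e'.1) :=
      fun e' hne => hgh _ (huniq e' hne)
    have hsum : ∑ e' : ↥Λ, (if torusEdge L e'.1 = e then ℓ e' else 0) = ℓ e₀ := by
      rw [Finset.sum_eq_single e₀ (fun e' _ hne => if_neg (huniq e' hne)) (fun h' => absurd (Finset.mem_univ _) h'), if_pos he₀]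
    rw [hsum]
    have h1 := hLip e₀ (fun e' => g (torusEdge L e'.1)) (fun e' => h (torusEdge L e'.1)) hagree
    rwa [he₀] at h1
  · push Not at hex
    have hagree : (fun e' : ↥Λ => ((g (torusEdge L e'.1) : SUN N) : Matrix (Fin N) (Fin N) ℂ)) =
        fun e' : ↥Λ => ((h (torusEdge L e'.1) : SUN N) : Matrix (Fin N) (Fin N) ℂ) :=
      funext fun e' => by rw [hgh _ (hex e')]
    rw [hagree, sub_self, abs_zero]
    exact mul_nonneg (Finset.sum_nonneg fun e' _ => by split_ifs; exacts [hℓ e', le_rfl]) (suFrobDist_nonneg _ _)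

/-- **The torus Lipschitz constants have the same sum of squares**: `Σ_e (Σ_{e'↦e} ℓ_{e'})² = Σ_{e'} ℓ_{e'}²` under injectivity. [folklore] -/
theorem sum_sq_cylinderLipschitz_torus (Λ : Finset (Literature.MathematicalPhysics.QuantumLattice.ZdEdge d))
    (hinj : Set.InjOn (torusEdge (d := d) L) ↑Λ) (ℓ : ↥Λ → ℝ) :
    ∑ e : Edge d L, (∑ e' : ↥Λ, if torusEdge L e'.1 = e then ℓ e' else 0) ^ 2 = ∑ e' : ↥Λ, ℓ e' ^ 2 := by
  classical
  -- adapted from g38's `ShenZhuZhuFunctionalInequalitiesSU2` (`hsumℓ`)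
  have hsq : ∀ e : Edge d L, (∑ e' : ↥Λ, if torusEdge L e'.1 = e then ℓ e' else 0) ^ 2 =
      ∑ e' : ↥Λ, if torusEdge L e'.1 = e then ℓ e' ^ 2 else 0 := by
    intro e
    by_cases hex : ∃ e₀ : ↥Λ, torusEdge L e₀.1 = e
    · obtain ⟨e₀, he₀⟩ := hex
      have huniq : ∀ e' : ↥Λ, e' ≠ e₀ → torusEdge L e'.1 ≠ e := by
        intro e' hne hEq
        exact hne (Subtype.ext (hinj e'.2 e₀.2 (hEq.trans he₀.symm)))
      rw [Finset.sum_eq_single e₀ (fun e' _ hne => if_neg (huniq e' hne)) (fun h' => absurd (Finset.mem_univ _) h'), if_pos he₀,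
        Finset.sum_eq_single e₀ (fun e' _ hne => if_neg (huniq e' hne)) (fun h' => absurd (Finset.mem_univ _) h'), if_pos he₀]
    · push Not at hex
      rw [Finset.sum_eq_zero fun e' _ => if_neg (hex e'), Finset.sum_eq_zero fun e' _ => if_neg (hex e')]
      ring
  simp_rw [hsq]
  rw [Finset.sum_comm]
  refine Finset.sum_congr rfl fun e' _ => ?_
  rw [Finset.sum_ite_eq Finset.univ (torusEdge L e'.1) (fun _ => ℓ e' ^ 2), if_pos (Finset.mem_univ _)]

/-- ★★ **Variance of link-Lipschitz cylinder observables on every torus, every `SU(N)`, every `d`**: for `K = N/2 − 4dN|β| > 0`, `Λ ⊂ E⁺(ℤ^d)` mapped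
injectively to `(ℤ/L)^d`, `f` smooth and `ℓ_e`-Lipschitz in the link `e` (Frobenius distance):
`Var_{μ_{Λ_L,Nβ}}(f((U_e)_{e∈Λ}) ∘ lift) ≤ Σ_e ℓ_e²/K`.  The Yang–Mills mass gap is NOT proved. [cite: ShenZhuZhu2022, Corollary 4.4 (4.11)] -/
theorem torus_cylinder_variance_sun (hN : N ≠ 0) {β : ℝ} (hK : 0 < (N : ℝ) / 2 - N * |β| * (4 * d))
    (Λ : Finset (Literature.MathematicalPhysics.QuantumLattice.ZdEdge d)) (hinj : Set.InjOn (torusEdge (d := d) L) ↑Λ)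
    (f : (↥Λ → Matrix (Fin N) (Fin N) ℂ) → ℝ) (hf : ContDiff ℝ ∞ f) (ℓ : ↥Λ → ℝ) (hℓ : ∀ e, 0 ≤ ℓ e)
    (hLip : ∀ (e : ↥Λ) (M M' : ↥Λ → SUN N), (∀ e', e' ≠ e → M e' = M' e') →
      |f (fun e' => (M e' : Matrix (Fin N) (Fin N) ℂ)) - f (fun e' => (M' e' : Matrix (Fin N) (Fin N) ℂ))| ≤ ℓ e * suFrobDist (M e) (M' e)) :
    Var[fun V : GaugeConfig d L (SUN N) => matrixCylinder Λ f (torusLift L V); wilsonMeasure (d := d) (L := L) (fundamentalRep (Fin N)) ((N : ℝ) * β)] ≤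
      (∑ e, ℓ e ^ 2) / ((N : ℝ) / 2 - N * |β| * (4 * d)) := by
  classical
  have hu : ContDiff ℝ ∞ fun Q : Cfg (Edge d L) N => f fun e' : ↥Λ => Q (torusEdge L e'.1) :=
    hf.comp (contDiff_pi.2 fun e' => contDiff_apply ℝ (Matrix (Fin N) (Fin N) ℂ) (torusEdge L e'.1))
  have h := torus_variance_le_of_linkLipschitz_sun (L := L) hN hK hu
    (fun e => Finset.sum_nonneg fun e' _ => by split_ifs; exacts [hℓ e', le_rfl]) (linkLipschitz_cylinder_torus Λ hinj f ℓ hℓ hLip)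
  have hfun : (fun U : GaugeConfig d L (SUN N) => f fun e' : ↥Λ => emb U (torusEdge L e'.1)) =
      fun V => matrixCylinder Λ f (torusLift L V) := by
    funext V; rfl
  rw [hfun, sum_sq_cylinderLipschitz_torus Λ hinj ℓ] at h
  exact h

/-! ## §2. Wilson loops on the torus, every `SU(N)`, every `d` -/

/-- ★★★ **Variance of Wilson loops on every torus, every `SU(N)`, every `d`, uniformly in the volume**: for `K = N/2 − 4dN|β| > 0` and every closed
lattice walk `C` whose links stay distinct on `(ℤ/L)^d`, `Var_{μ_{Λ_L,Nβ}}(W_C∘lift) ≤ Σ_{e ∈ links(C)} mult_C(e)²/(N·K)`, `W_C = (1/N) Re tr hol_C`.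
The Yang–Mills mass gap is NOT proved. [cite: ShenZhuZhu2022, Corollary 1.5, Remark 4.6] -/
theorem torus_wilsonLoop_variance_sun (hN : N ≠ 0) {β : ℝ} (hK : 0 < (N : ℝ) / 2 - N * |β| * (4 * d))
    {x : Literature.Probability.LatticeModels.Site d} (w : (zdGraph d).Walk x x) (hinj : Set.InjOn (torusEdge (d := d) L) ↑(walkEdges w)) :
    Var[fun V : GaugeConfig d L (SUN N) => wilsonLoopObs (fun g : SUN N => normalisedCharacter N (fundamentalRep (Fin N) g)) w (torusLift L V);
        wilsonMeasure (d := d) (L := L) (fundamentalRep (Fin N)) ((N : ℝ) * β)] ≤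
      (∑ e ∈ walkEdges w, (dartMult w e : ℝ) ^ 2) / (N * ((N : ℝ) / 2 - N * |β| * (4 * d))) := by
  classical
  obtain ⟨f, hf, hrep, hLip⟩ := exists_smooth_linkLipschitz_wilsonLoopObs (N := N) w
  set ℓ : ↥(walkEdges w) → ℝ := fun e =>
    (dartMult w (e : Literature.MathematicalPhysics.QuantumLattice.ZdEdge d) : ℝ) / Real.sqrt (N : ℝ) with hℓdef
  have hℓ : ∀ e, 0 ≤ ℓ e := fun e => div_nonneg (Nat.cast_nonneg _) (Real.sqrt_nonneg _)
  have hNpos : (0 : ℝ) < N := by exact_mod_cast Nat.pos_of_ne_zero hN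
  have hsum : ∑ e, ℓ e ^ 2 = (∑ e ∈ walkEdges w, (dartMult w e : ℝ) ^ 2) / N := by
    have h2 : Real.sqrt (N : ℝ) ^ 2 = N := Real.sq_sqrt (Nat.cast_nonneg _)
    simp only [hℓdef, div_pow, h2]
    rw [← Finset.sum_div, Finset.sum_coe_sort (walkEdges w) (fun e => (dartMult w e : ℝ) ^ 2)]
  have h := torus_cylinder_variance_sun (L := L) hN hK (walkEdges w) hinj f hf ℓ hℓ hLip
  have hF : (fun V : GaugeConfig d L (SUN N) => matrixCylinder (walkEdges w) f (torusLift L V)) =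
      fun V => wilsonLoopObs (fun g : SUN N => normalisedCharacter N (fundamentalRep (Fin N) g)) w (torusLift L V) :=
    funext fun V => hrep _
  rw [hF, hsum, div_div] at h
  exact h

/-- ★★ **Perimeter growth of Wilson-loop fluctuations, closed trails, every `SU(N)`, every `d`**: `Var_{μ_{Λ_L,Nβ}}(W_C∘lift) ≤ |C|/(N·K)` for every
closed trail `C` (no link twice) whose links stay distinct on `(ℤ/L)^d`.  The Yang–Mills mass gap is NOT proved. [cite: ShenZhuZhu2022, Corollary 1.5] -/
theorem torus_wilsonLoop_variance_sun_of_isTrail (hN : N ≠ 0) {β : ℝ} (hK : 0 < (N : ℝ) / 2 - N * |β| * (4 * d))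
    {x : Literature.Probability.LatticeModels.Site d} {w : (zdGraph d).Walk x x} (htr : w.IsTrail)
    (hinj : Set.InjOn (torusEdge (d := d) L) ↑(walkEdges w)) :
    Var[fun V : GaugeConfig d L (SUN N) => wilsonLoopObs (fun g : SUN N => normalisedCharacter N (fundamentalRep (Fin N) g)) w (torusLift L V);
        wilsonMeasure (d := d) (L := L) (fundamentalRep (Fin N)) ((N : ℝ) * β)] ≤
      (w.length : ℝ) / (N * ((N : ℝ) / 2 - N * |β| * (4 * d))) := by
  have h := torus_wilsonLoop_variance_sun (L := L) hN hK w hinj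
  rw [sum_dartMult_sq_eq_length_of_isTrail htr] at h
  exact h

/-! ## §3. Rectangular Wilson loops in the tree's finite-volume vocabulary -/

/-- ★★★ **Perimeter growth of Wilson-loop fluctuations on every torus, every `SU(N)`, every `d ≥ 2`** (tree vocabulary): for the periodic Wilson
measure `wilsonMeasure (fundamentalRep (Fin N)) (Nβ)` on `(ℤ/L)^d` with `K = N/2 − 4dN|β| > 0` (`|β| < 1/(8d)`), every base point `x`, directions
`i ≠ j` and side lengths `1 ≤ R, T < L`:  `Var[wilsonLoop (fundamentalRep (Fin N)) x i j R T] ≤ 2(R + T)/(N·K)` — the same bound in every volume.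
The Yang–Mills mass gap is NOT proved. [cite: ShenZhuZhu2022, Corollary 1.5, Remark 4.6] -/
theorem torus_wilsonLoop_rect_variance_sun (hN : N ≠ 0) {β : ℝ} (hK : 0 < (N : ℝ) / 2 - N * |β| * (4 * d))
    (x : Literature.MathematicalPhysics.QuantumFieldTheory.Site d L) {i j : Fin d} (hij : i ≠ j) {R T : ℕ}
    (hR : 1 ≤ R) (hT : 1 ≤ T) (hRL : R < L) (hTL : T < L) :
    Var[wilsonLoop (fundamentalRep (Fin N)) x i j R T; wilsonMeasure (d := d) (L := L) (fundamentalRep (Fin N)) ((N : ℝ) * β)] ≤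
      2 * ((R : ℝ) + T) / (N * ((N : ℝ) / 2 - N * |β| * (4 * d))) := by
  classical
  -- lift the base point to `ℤ^d`
  set x₀ : Literature.Probability.LatticeModels.Site d := fun k => ((x k).val : ℤ) with hx₀
  have hx : Torus.proj L x₀ = x := by
    funext k
    rw [Torus.proj_apply, hx₀]
    simp only [Int.cast_natCast, ZMod.natCast_zmod_val]
  have hW : (fun V : GaugeConfig d L (SUN N) =>
      wilsonLoopObs (fun g : SUN N => normalisedCharacter N (fundamentalRep (Fin N) g)) (rectWalk x₀ i j R T) (torusLift L V)) =
        wilsonLoop (fundamentalRep (Fin N)) x i j R T := by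
    funext V; rw [wilsonLoopObs_rectWalk_torusLift, hx]
  have h := torus_wilsonLoop_variance_sun (L := L) hN hK (rectWalk x₀ i j R T) (injOn_torusEdge_walkEdges_rectWalk L x₀ hij hRL hTL)
  rw [hW, sum_dartMult_sq_rectWalk x₀ hij hR hT] at h
  exact h

end Summit.QuantumFields.YangMills.Theorems.ColdStartUniversality

end
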